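import Summits.QuantumFields.GaugeBoot.ZdCentralTwist
import Literature.MathematicalPhysics.QuantumLattice.WilsonLoops
import HarnessLib

/-!
# The `ℤ^d` staggered central twist on ARBITRARY lattice walks: the collected weight, shoelace
# sums, telescoping, and the lattice area parity (gauge-boot, L3 structural supplement; `ℤ^d` twist 8)

HONEST FRAMING (cell `pub-gaugeboot`, page 1 of every file): the venture produces certified bounds
on lattice expectations at stated coupling, gauge group, dimension and torus size; NOT a mass gap,
NOT a continuum limit, NOT a string tension; NOT Yang–Mills-summit-bearing (barriers
`FixedCouplingUltralocality`, `PerturbativeInvisibility`). This module bounds no expectation; no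
certificate of the cell sits at `β < 0`. Structural bookkeeping for the Wilson-loop form of the
`β ↦ -β` twist (sequels `ZdCentralTwistLoops.lean`, `ZdCentralTwistRectangleArea.lean`).

`ZdCentralTwistWilsonLoops.lean` (twist 7) treated RECTANGLES (`hol_{R×T}(T U) = z^{RT} hol_{R×T}(U)`).
Here the discrete-Stokes bookkeeping for EVERY walk of the tree's `ℤ^d` Wilson-loop vocabulary
(`Literature.MathematicalPhysics.QuantumLattice.WilsonLoops`: `walkHolonomy`, `dartStep`, `dartDir`
of a Mathlib `SimpleGraph.Walk` of `zdGraph d`):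
* `walkSign s w = ∏_{e ∈ w} s(e)`; ★ `walkHolonomy_centralTwist` — **`hol_w(T_s U) = walkSign s w ·
  hol_w(U)` for every walk and all central involutive link weights** (every staggering);
* parity staggerings `s = stagTwist π r z`: `parity_snd` (`π_j(end e) = π_j(start e) + [j = dir e]`),
  `stagParity_dartStep`, ★ `walkSign_stagTwist` — the weight is `z^{twistParity π r w}` with
  `twistParity π r w = ∑_{e ∈ w} c(start e, dir e) = ∑_{e ∈ w} ∑_{i ≺_r dir e} π_i(start e)`, a
  SHOELACE sum; `walkHolonomy_centralTwist_stagTwist`;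
* `sum_darts_telescope` (`∑_{e ∈ w} (f(end e) - f(start e)) = f(y) - f(x)`, `w : x ⟶ y`) and its two
  uses: `dirParity_eq` (the number of steps in direction `k` is `π_k(y) - π_k(x) (mod 2)`, EVEN on a
  closed walk) and ★ `shoelaceParity_add_swap` — for the mod-2 shoelace areas
  `S_{ik}(w) = shoelaceParity π i k w = ∑_{e ∈ w, dir e = k} π_i(start e)` of the coordinate-plane
  projections, `S_{ik} + S_{ki} = π_i(y)π_k(y) - π_i(x)π_k(x)` (`i ≠ k`; symmetric on closed walks);
* `areaParity π w = ∑_{i<k} S_{ik}(w)`, **the lattice area parity**; `twistParity_eq_areaParity_add`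
  (every walk) and ★★ `twistParity_eq_areaParity` — **on a CLOSED walk the collected parity is the
  area parity, whatever the axis `r`** (`twistParity_eq_of_closed`).

What is NOT claimed: nothing about measures here (sequels); the sign rule for a general (non-parity)
staggering needs the discrete Poincaré lemma and is not typed. [folklore] bookkeeping (Kogut–Susskind
1975; Li–Meurice 2005 §II; the shoelace bookkeeping is classical).
-/

noncomputable section

open MeasureTheory Filter Topology SimpleGraph
open Literature.Probability.LatticeModels (Site zdGraph)
open Literature.MathematicalPhysics.QuantumLattice

namespace Summit.QuantumFields.GaugeBoot

namespace TiltedRP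

variable {d N : ℕ} {G : Type*} [Group G]

/-! ## The weight a walk collects under a central twist -/

section WalkSign

/-- **The twist weight collected by a lattice walk**: the ordered product `∏_{e ∈ w} s(e)` of the
weights of the (unoriented) links traversed by `w`, with multiplicity. -/
def walkSign (s : ZdEdge d → G) {x y : Site d} (w : (zdGraph d).Walk x y) : G :=
  (w.darts.map fun e => s (dartStep e).1).prod

/-- The trivial walk collects `1`. -/
@[simp] theorem walkSign_nil (s : ZdEdge d → G) (x : Site d) :
    walkSign s (Walk.nil : (zdGraph d).Walk x x) = 1 := by simp [walkSign]

/-- A first dart contributes its link weight. -/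
@[simp] theorem walkSign_cons (s : ZdEdge d → G) {x y y' : Site d} (h : (zdGraph d).Adj x y)
    (w : (zdGraph d).Walk y y') :
    walkSign s (Walk.cons h w) = s (dartStep ⟨(x, y), h⟩).1 * walkSign s w := by simp [walkSign]

/-- The collected weight is multiplicative under concatenation. -/
theorem walkSign_append (s : ZdEdge d → G) {x y y' : Site d} (p : (zdGraph d).Walk x y)
    (q : (zdGraph d).Walk y y') : walkSign s (p.append q) = walkSign s p * walkSign s q := by
  simp [walkSign]

variable {s : ZdEdge d → G}

/-- For central weights the collected weight is central. -/
theorem walkSign_comm (hc : ∀ l g, s l * g = g * s l) {x y : Site d} (w : (zdGraph d).Walk x y)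
    (g : G) : walkSign s w * g = g * walkSign s w := by
  induction w with
  | nil => simp
  | cons h w ih => rw [walkSign_cons, mul_assoc, ih, ← mul_assoc, hc, mul_assoc]

/-- For central involutive weights the reversed walk collects the same weight. -/
theorem walkSign_reverse (hc : ∀ l g, s l * g = g * s l) {x y : Site d}
    (w : (zdGraph d).Walk x y) : walkSign s w.reverse = walkSign s w := by
  induction w with
  | nil => simp
  | cons h w ih =>
    rw [Walk.reverse_cons, walkSign_append, ih, walkSign_cons, walkSign_cons, walkSign_nil, mul_one,
      walkSign_comm hc]
    congr 2
    exact (congrArg Prod.fst (dartStep_symm (⟨(_, _), h⟩ : (zdGraph d).Dart)) :)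

/-- **One dart**: `hol_e(T_s U) = s(e) · hol_e(U)` (for the backward orientation
`(s U)⁻¹ = U⁻¹ s⁻¹ = s U⁻¹` uses that `s(e)` is a central involution). -/
theorem dartHolonomy_centralTwist (hc : ∀ l g, s l * g = g * s l) (h2 : ∀ l, s l * s l = 1)
    (U : LGConfig d G) (e : (zdGraph d).Dart) :
    dartHolonomy (centralTwist s U) e = s (dartStep e).1 * dartHolonomy U e := by
  unfold dartHolonomy
  simp only [centralTwist_apply]
  split_ifs
  · rfl
  · rw [mul_inv_rev, inv_eq_of_mul_eq_one_right (h2 _), hc]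

/-- ★ **The twist on the holonomy of an arbitrary walk**: `hol_w(T_s U) = walkSign s w · hol_w(U)`
for central involutive link weights `s` — every link weight met along the walk is moved to the
front. -/
theorem walkHolonomy_centralTwist (hc : ∀ l g, s l * g = g * s l) (h2 : ∀ l, s l * s l = 1)
    (U : LGConfig d G) {x y : Site d} (w : (zdGraph d).Walk x y) :
    walkHolonomy (centralTwist s U) w = walkSign s w * walkHolonomy U w := by
  induction w with
  | nil => simp
  | cons h w ih =>
    rw [walkHolonomy_cons, walkHolonomy_cons, ih, dartHolonomy_centralTwist hc h2, walkSign_cons]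
    simp only [mul_assoc]
    rw [← mul_assoc (dartHolonomy U _), ← walkSign_comm hc w (dartHolonomy U _), mul_assoc]

/-- **Every staggering** of `(ℤ^d, zdUnit)`: `hol_w(T_s U) = walkSign s w · hol_w(U)`. -/
theorem IsStaggering.walkHolonomy_centralTwist {z : G} (hs : IsStaggering (zdUnit d) z s)
    (U : LGConfig d G) {x y : Site d} (w : (zdGraph d).Walk x y) :
    walkHolonomy (centralTwist s U) w = walkSign s w * walkHolonomy U w :=
  TiltedRP.walkHolonomy_centralTwist hs.comm hs.mul_self U w

end WalkSign

/-! ## Parity staggerings: the collected weight is `z^{shoelace sum}` -/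

section Parity

variable {z : G} {π : Fin d → Site d →+ ZMod 2}

/-- **Along a dart every coordinate parity changes by `[j = dir e]`**: `π_j(end e) = π_j(start e) +
[j = dir e]` (both orientations at once, since `-1 = 1 (mod 2)`). -/
theorem parity_snd (hπ : IsDualParity (zdUnit d) π) (j : Fin d) (e : (zdGraph d).Dart) :
    π j e.snd = π j e.fst + if j = dartDir e then 1 else 0 := by
  have h := hπ j (dartDir e)
  rw [zdUnit_apply] at h
  have h2 : ∀ a : ZMod 2, a + a = 0 := by decide
  rcases dartDir_spec e with he | he
  · rw [he, map_add, h]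
  · rw [he, map_add, h, add_assoc, h2, add_zero]

/-- The staggered parity of the link under a dart is read at the START of the dart (for the
backward orientation the base point is `start - e_{dir}`, and `c(·, m)` is constant along `m`). -/
theorem stagParity_dartStep (hπ : IsDualParity (zdUnit d) π) (r : Fin d) (e : (zdGraph d).Dart) :
    stagParity π r (dartStep e).1 = stagParity π r (e.fst, dartDir e) := by
  unfold dartStep
  split_ifs with h
  · rfl
  · have he : e.fst = e.snd + zdUnit d (dartDir e) := by
      rw [zdUnit_apply]; exact (dartDir_spec e).resolve_left h
    rw [he, stagParity_add_e hπ r,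
      if_neg (fun h' : PrecLast r (dartDir e) (dartDir e) => h'.2.elim h'.1 (lt_irrefl _)), add_zero]

/-- **The parity collected by a walk** under the staggering with axis `r` last:
`∑_{e ∈ w} c(start e, dir e) = ∑_{e ∈ w} ∑_{i ≺_r dir e} π_i(start e)` — a shoelace sum. -/
def twistParity (π : Fin d → Site d →+ ZMod 2) (r : Fin d) {x y : Site d}
    (w : (zdGraph d).Walk x y) : ZMod 2 :=
  (w.darts.map fun e => stagParity π r (e.fst, dartDir e)).sum

/-- The trivial walk collects parity `0`. -/
@[simp] theorem twistParity_nil (r : Fin d) (x : Site d) :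
    twistParity π r (Walk.nil : (zdGraph d).Walk x x) = 0 := by simp [twistParity]

/-- A first dart contributes the parity of its link. -/
@[simp] theorem twistParity_cons (r : Fin d) {x y y' : Site d} (h : (zdGraph d).Adj x y)
    (w : (zdGraph d).Walk y y') :
    twistParity π r (Walk.cons h w) =
      stagParity π r (x, dartDir ⟨(x, y), h⟩) + twistParity π r w := by
  simp [twistParity]

/-- The collected parity is additive under concatenation. -/
theorem twistParity_append (r : Fin d) {x y y' : Site d} (p : (zdGraph d).Walk x y)
    (q : (zdGraph d).Walk y y') :
    twistParity π r (p.append q) = twistParity π r p + twistParity π r q := by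
  simp [twistParity]

/-- ★ **The weight collected under the parity staggering is `z^{twistParity}`.** -/
theorem walkSign_stagTwist (hπ : IsDualParity (zdUnit d) π) (hz2 : z * z = 1) (r : Fin d)
    {x y : Site d} (w : (zdGraph d).Walk x y) :
    walkSign (stagTwist π r z) w = zpow₂ z (twistParity π r w) := by
  induction w with
  | nil => simp [zpow₂]
  | cons h w ih =>
    rw [walkSign_cons, twistParity_cons, ih, stagTwist, stagParity_dartStep hπ r, zpow₂_add hz2]

/-- ★ **`hol_w(T U) = z^{twistParity π r w} · hol_w(U)` for every walk** (`z` central, `z² = 1`). -/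
theorem walkHolonomy_centralTwist_stagTwist (hπ : IsDualParity (zdUnit d) π)
    (hzc : ∀ g : G, z * g = g * z) (hz2 : z * z = 1) (r : Fin d) (U : LGConfig d G)
    {x y : Site d} (w : (zdGraph d).Walk x y) :
    walkHolonomy (centralTwist (stagTwist π r z) U) w =
      zpow₂ z (twistParity π r w) * walkHolonomy U w := by
  have hs := isStaggering_stagTwist (G := G) (e := zdUnit d) hπ r hzc hz2
  rw [hs.walkHolonomy_centralTwist U w, walkSign_stagTwist hπ hz2 r w]

end Parity

/-! ## Telescoping along a walk: direction counts and the shoelace antisymmetry -/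

section Telescope

variable {π : Fin d → Site d →+ ZMod 2}

/-- **Telescoping along a walk**: `∑_{e ∈ w} (f(end e) - f(start e)) = f(y) - f(x)` for
`w : x ⟶ y`. -/
theorem sum_darts_telescope {M : Type*} [AddCommGroup M] (f : Site d → M) {x y : Site d}
    (w : (zdGraph d).Walk x y) : (w.darts.map fun e => f e.snd - f e.fst).sum = f y - f x := by
  induction w with
  | nil => simp
  | @cons u v y' h w ih =>
    rw [Walk.darts_cons, List.map_cons, List.sum_cons, ih]
    show f v - f u + (f y' - f v) = f y' - f u
    abel

/-- **Direction counts mod 2**: the number of darts of `w : x ⟶ y` in direction `k` is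
`π_k(y) - π_k(x) (mod 2)`; in particular it is EVEN for a closed walk (`dirParity_eq_zero`). -/
theorem dirParity_eq (hπ : IsDualParity (zdUnit d) π) (k : Fin d) {x y : Site d}
    (w : (zdGraph d).Walk x y) :
    (w.darts.map fun e => if k = dartDir e then (1 : ZMod 2) else 0).sum = π k y - π k x := by
  rw [← sum_darts_telescope (π k) w]
  congr 1
  refine List.map_congr_left fun e _ => ?_
  rw [parity_snd hπ k e, add_sub_cancel_left]

/-- A closed walk has an even number of darts in every direction. -/
theorem dirParity_eq_zero (hπ : IsDualParity (zdUnit d) π) (k : Fin d) {x : Site d}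
    (w : (zdGraph d).Walk x x) :
    (w.darts.map fun e => if k = dartDir e then (1 : ZMod 2) else 0).sum = 0 := by
  rw [dirParity_eq hπ k w, sub_self]

/-- **The mod-2 shoelace area** of the projection of the walk `w` to the `(i, k)` coordinate plane:
`S_{ik}(w) = ∑_{e ∈ w, dir e = k} π_i(start e)` (`∮ x_i dx_k (mod 2)`; orientations are invisible
mod 2). -/
def shoelaceParity (π : Fin d → Site d →+ ZMod 2) (i k : Fin d) {x y : Site d}
    (w : (zdGraph d).Walk x y) : ZMod 2 :=
  (w.darts.map fun e => if k = dartDir e then π i e.fst else 0).sum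

/-- The trivial walk has shoelace area `0`. -/
@[simp] theorem shoelaceParity_nil (i k : Fin d) (x : Site d) :
    shoelaceParity π i k (Walk.nil : (zdGraph d).Walk x x) = 0 := by simp [shoelaceParity]

/-- A first dart in direction `k` contributes `π_i` of its start. -/
@[simp] theorem shoelaceParity_cons (i k : Fin d) {x y y' : Site d} (h : (zdGraph d).Adj x y)
    (w : (zdGraph d).Walk y y') :
    shoelaceParity π i k (Walk.cons h w) =
      (if k = dartDir ⟨(x, y), h⟩ then π i x else 0) + shoelaceParity π i k w := by
  simp [shoelaceParity]

/-- The shoelace area is additive under concatenation. -/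
theorem shoelaceParity_append (i k : Fin d) {x y y' : Site d} (p : (zdGraph d).Walk x y)
    (q : (zdGraph d).Walk y y') :
    shoelaceParity π i k (p.append q) = shoelaceParity π i k p + shoelaceParity π i k q := by
  simp [shoelaceParity]

/-- ★ **The mod-2 shoelace antisymmetry**: `S_{ik}(w) + S_{ki}(w) = π_i(y)π_k(y) - π_i(x)π_k(x)`
for `w : x ⟶ y` and `i ≠ k` — the telescoping of `π_i π_k` along the walk
(`∮ d(x_i x_k) = ∮ x_i dx_k + ∮ x_k dx_i`). -/
theorem shoelaceParity_add_swap (hπ : IsDualParity (zdUnit d) π) {i k : Fin d} (hik : i ≠ k)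
    {x y : Site d} (w : (zdGraph d).Walk x y) :
    shoelaceParity π i k w + shoelaceParity π k i w = π i y * π k y - π i x * π k x := by
  rw [← sum_darts_telescope (fun v => π i v * π k v) w, shoelaceParity, shoelaceParity,
    ← List.sum_map_add]
  congr 1
  refine List.map_congr_left fun e _ => ?_
  rw [parity_snd hπ i e, parity_snd hπ k e]
  by_cases hi : i = dartDir e
  · have hk : ¬k = dartDir e := fun hk => hik (hi.trans hk.symm)
    rw [if_neg hk, if_pos hi, if_pos hi, if_neg hk]
    ring
  · by_cases hk : k = dartDir e
    · rw [if_pos hk, if_neg hi, if_neg hi, if_pos hk]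
      ring
    · rw [if_neg hk, if_neg hi, if_neg hi, if_neg hk]
      ring

/-- **On a closed walk the mod-2 shoelace area is symmetric**: `S_{ik}(C) = S_{ki}(C)` (`i ≠ k`). -/
theorem shoelaceParity_swap_of_closed (hπ : IsDualParity (zdUnit d) π) {i k : Fin d} (hik : i ≠ k)
    {x : Site d} (w : (zdGraph d).Walk x x) :
    shoelaceParity π i k w = shoelaceParity π k i w := by
  have h := shoelaceParity_add_swap hπ hik w
  rw [sub_self] at h
  rw [eq_neg_of_add_eq_zero_left h, ZMod.neg_eq_self_mod_two]

end Telescope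

/-! ## The collected parity of a CLOSED walk is its lattice area parity -/

section Area

variable {π : Fin d → Site d →+ ZMod 2}

/-- **The lattice area parity** of a walk: `a(w) = ∑_{i < k} S_{ik}(w)`, the sum over the coordinate
planes of the mod-2 shoelace areas of the projections of `w` — for a closed walk, the parity of
the (winding-number weighted) number of unit squares of any lattice surface it bounds. -/
def areaParity (π : Fin d → Site d →+ ZMod 2) {x y : Site d} (w : (zdGraph d).Walk x y) : ZMod 2 :=
  ∑ i, ∑ k, if i < k then shoelaceParity π i k w else 0

/-- **The collected parity as a sum of shoelace areas**: `twistParity π r w = ∑_{i ≺_r k} S_{ik}(w)`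
(every walk). -/
theorem twistParity_eq_sum_shoelaceParity (r : Fin d) {x y : Site d} (w : (zdGraph d).Walk x y) :
    twistParity π r w = ∑ i, ∑ k, if PrecLast r i k then shoelaceParity π i k w else 0 := by
  induction w with
  | nil => simp
  | @cons u v y' h w ih =>
    rw [twistParity_cons, ih]
    simp only [shoelaceParity_cons]
    have hsplit : ∀ i k : Fin d,
        (if PrecLast r i k then
            (if k = dartDir ⟨(u, v), h⟩ then π i u else 0) + shoelaceParity π i k w else 0) =
          (if k = dartDir ⟨(u, v), h⟩ then (if PrecLast r i k then π i u else 0) else 0) +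
            if PrecLast r i k then shoelaceParity π i k w else 0 := by
      intro i k
      split_ifs <;> simp
    simp only [hsplit, Finset.sum_add_distrib, Finset.sum_ite_eq', Finset.mem_univ, if_true]
    congr 1
    unfold stagParity
    rw [Finset.sum_filter]

/-- `[i ≺_r k] = [i < k ∧ i ≠ r] + [k = r ∧ r < i]` and `[i < k] = [i < k ∧ i ≠ r] + [i = r ∧ r < k]`:
the pointwise bookkeeping behind `twistParity_eq_areaParity_add`. -/
theorem ite_precLast_sub_ite_lt (r i k : Fin d) (S : ZMod 2) :
    ((if PrecLast r i k then S else 0) - if i < k then S else 0) =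
      (if k = r ∧ r < i then S else 0) - if i = r ∧ r < k then S else 0 := by
  unfold PrecLast
  by_cases hir : i = r
  · subst hir
    by_cases hik : i < k
    · have hki : k ≠ i := fun h => lt_irrefl _ (h ▸ hik)
      simp [hik, hki]
    · simp [hik]
  · by_cases hkr : k = r
    · subst hkr
      by_cases hik : i < k
      · have : ¬k < i := lt_asymm hik
        simp [hir, hik, this]
      · have hki : k < i := lt_of_le_of_ne (not_lt.1 hik) (fun h => hir h.symm)
        simp [hir, hik, hki]
    · simp [hir, hkr]

/-- **The collected parity versus the area parity, every walk**:
`twistParity π r w = a(w) + ∑_{k > r} (S_{kr}(w) + S_{rk}(w))` (mod 2). -/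
theorem twistParity_eq_areaParity_add (r : Fin d) {x y : Site d} (w : (zdGraph d).Walk x y) :
    twistParity π r w = areaParity π w +
      ∑ k, if r < k then shoelaceParity π k r w + shoelaceParity π r k w else 0 := by
  rw [twistParity_eq_sum_shoelaceParity, areaParity]
  have h1 : (∑ i, ∑ k, if k = r ∧ r < i then shoelaceParity π i k w else 0) =
      ∑ i, if r < i then shoelaceParity π i r w else 0 := by
    refine Finset.sum_congr rfl fun i _ => ?_
    have : ∀ k, (if k = r ∧ r < i then shoelaceParity π i k w else 0) =
        if k = r then (if r < i then shoelaceParity π i k w else 0) else 0 := fun k => by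
      split_ifs <;> simp_all
    simp only [this, Finset.sum_ite_eq', Finset.mem_univ, if_true]
  have h2 : (∑ i, ∑ k, if i = r ∧ r < k then shoelaceParity π i k w else 0) =
      ∑ k, if r < k then shoelaceParity π r k w else 0 := by
    rw [Finset.sum_comm]
    refine Finset.sum_congr rfl fun k _ => ?_
    have : ∀ i, (if i = r ∧ r < k then shoelaceParity π i k w else 0) =
        if i = r then (if r < k then shoelaceParity π i k w else 0) else 0 := fun i => by
      split_ifs <;> simp_all
    simp only [this, Finset.sum_ite_eq', Finset.mem_univ, if_true]
  have hdiff : ((∑ i, ∑ k, if PrecLast r i k then shoelaceParity π i k w else 0) -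
      ∑ i, ∑ k, if i < k then shoelaceParity π i k w else 0) =
      (∑ i, if r < i then shoelaceParity π i r w else 0) -
        ∑ k, if r < k then shoelaceParity π r k w else 0 := by
    rw [← h1, ← h2, ← Finset.sum_sub_distrib, ← Finset.sum_sub_distrib]
    refine Finset.sum_congr rfl fun i _ => ?_
    rw [← Finset.sum_sub_distrib, ← Finset.sum_sub_distrib]
    exact Finset.sum_congr rfl fun k _ => ite_precLast_sub_ite_lt r i k _
  rw [← sub_eq_iff_eq_add', hdiff, ← Finset.sum_sub_distrib]
  refine Finset.sum_congr rfl fun k _ => ?_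
  split_ifs
  · rw [sub_eq_add_neg, ZMod.neg_eq_self_mod_two]
  · rw [sub_zero]

/-- ★★ **For a CLOSED walk the collected parity is the lattice area parity, whatever the axis `r`
put last**: `twistParity π r C = a(C)` (the correction terms `S_{kr} + S_{rk}` vanish on closed
walks by the shoelace antisymmetry). -/
theorem twistParity_eq_areaParity (hπ : IsDualParity (zdUnit d) π) (r : Fin d) {x : Site d}
    (w : (zdGraph d).Walk x x) : twistParity π r w = areaParity π w := by
  rw [twistParity_eq_areaParity_add r w, add_eq_left]
  refine Finset.sum_eq_zero fun k _ => ?_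
  split_ifs with hk
  · rw [shoelaceParity_add_swap hπ (ne_of_gt hk) w, sub_self]
  · rfl

/-- **The collected parity of a closed walk does not depend on the axis put last.** -/
theorem twistParity_eq_of_closed (hπ : IsDualParity (zdUnit d) π) (r r' : Fin d) {x : Site d}
    (w : (zdGraph d).Walk x x) : twistParity π r w = twistParity π r' w := by
  rw [twistParity_eq_areaParity hπ, twistParity_eq_areaParity hπ]

end Area

end TiltedRP

end Summit.QuantumFields.GaugeBoot
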